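import Literature.Probability.Percolation.TrapFramesReroute
import Literature.Probability.Percolation.TrapFenceAttach
import Literature.Probability.Percolation.AdjSurgery4
import HarnessLib

/-!
# The `k`-exit datum: Nolin's arm separation, outer half, any number of arms (surgery)

Topic: Probability / Percolation; family `crit-perc` (site percolation on the triangular lattice
`𝕋 = triGraph`). The combinatorial ("surgery") half of the outer step of Nolin's arm-separation
theorem for an ARBITRARY pattern `κ : Fin k → Bool` (Nolin 2008, Thm. 11, §4.4 [arXiv
0711.4948: Thm. 10, p. 12]: "each of the `j` arms induces … a crossing of one of the U-shaped
regions … any set of disjoint crossings can be made well-separated with high probability"),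
towards `Literature.Probability.Percolation.Nolin2008_prop17_quasiMult` (`FiveArmExponentFacts.lean`).
The tree had this step for four arms in the adjacent arrangement only
(`adjFourArmClean_subset_outMidExits4_union`, `AdjSurgery4.lean`, multiplicity `≤ 2` per colour,
by a cut-counting/Menger argument); here any number of arms of each colour is handled by the
generic rerouting of `TransversalReroute.lean` / `TrapFramesReroute.lean` (after
Kesten–Sidoravicius–Zhang 1998, App. §7) and the fence attachment / no-invasion theorems of
`TrapFenceAttach.lean`.

On the good event `AdjGood P T T' Rg Kg` (behind each of the six sides and for both colours the
explorations of the lowest crossings are short and rawly good at some scale with `8k_j`-middle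
tips — the event whose failure probability and locality outside `Λ_M` are in `AdjGoodBound.lean`),
every configuration of `armEvent κ n (2M)` carries a `k`-EXIT DATUM (`OutMidExits κ P`): for every
arm a frame, an exit of its colour read in that frame (`TrapExit`: nominal middle tip on the outer
side, a scale, an open vertical crossing of the corner box through an exterior fence site, a start
of norm `n`) protected from below (`TipProt`), an open route of the colour from the start to the
fence site inside the annulus-or-exit-zone, tight outside `Λ_{2M}` and meeting `∂Λ_n` only at its
start; the actual structures (route and corner strip) of two arms of the same colour are disjoint;
tips on a common side are distinct, `17k` apart for equal colours and not within `8k` above for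
different colours. This is the input format of the landing estimates (locally monotone FKG and
RSW corridors, Nolin Lemma 13 / Fig. 6, p. 12), as in `AdjCover.lean` for four arms.

## Main definitions

* `OutMidExits κ P` — the `k`-exit datum event.

## Main results

* `exists_trimmed_member` — an arm is trimmed at its last visit to `∂Λ_n`.
* `FrameTransversals.iter_norm_ge`, `FrameTransversals.iter_eq_start` — two more invariants of
  the six-frame protocol (norms stay `≥ n`; the members meet `∂Λ_n` only at their start).
* `FrameTransversals.exit_route` — the reading of a final member in its last frame together with
  the connection of the fence of its last term is a route of an exit.
* `FrameTransversals.same_colour_pair` — the structures of two exits of one colour are disjoint;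
  on a common side the tips are distinct and `17k` apart.
* `tip_row_gap_of_compl` — tips of complementary colours on one side are distinct and not within
  `8k` above a raw-good tip (`TrapRawOK.no_escape`).
* `armEvent_inter_adjGood_subset_outMidExits` — `armEvent κ n (2M) ∩ AdjGood ⊆ OutMidExits κ P`
  (`1 ≤ n`, `2n ≤ M`, `2 ≤ k₀`, `64 k_j < M` for all scales).

## References

* P. Nolin, *Near-critical percolation in two dimensions*, Electron. J. Probab. 13 (2008), §4.4,
  Thm. 11 and Lemma 15 (proofs), Fig. 9 [arXiv 0711.4948: Thm. 10, Lemma 14]. [Nolin2008]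
* H. Kesten, V. Sidoravicius, Y. Zhang, *Almost all words are seen in critical site percolation
  on the triangular lattice*, Electron. J. Probab. 3 (1998), paper 10, App. §7 (7.9)–(7.10),
  p. 27. [KestenSidoraviciusZhang1998]
* H. Kesten, *Scaling relations for 2D-percolation*, Comm. Math. Phys. 109 (1987), Lemmas 2, 4.
  [Kesten1987]

Tree: `FrameTransversals` and its protocol (`TrapFramesReroute.lean`), `TermFence`,
`TrapRawOK.nonempty_termFence`, `fenceSet_box`, `mem_fenceSet_inside/outside`
(`TrapTermFence.lean`), `JDomain.Transversal.termFence_q_mem_reroute`,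
`JDomain.Transversal.not_mem_of_mem_termFence`, `termFence_disjoint_of_lt` (`TrapFenceAttach.lean`),
`AdjGood`, `FrameGood`, `TipProt`, `ExitTight`, `exitTight_of_mem_fenceSet`, `TrapExit`,
`trapExitZone`, `OParams`, `colCfg` (`AdjSurgery4.lean` and its imports), `rot_tipBox_ne`
(`AdjTipBoxes.lean`), `exists_trapRawOK_of_not_failRaw`, `TrapRawOK.no_escape`
(`ArmSeparationRawGood.lean`), `armEvent` (`ArmEvents.lean`), `PathIn.last_exit`,
`PathIn.exists_support` (`SitePaths.lean`, `TriRSWChaining.lean`).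
-/

noncomputable section

namespace Literature.Probability.Percolation

open LatticeModels

open JDomain

/-! ### Trimming an arm at its last visit to `∂Λ_n` -/

/-- **Trimming**: a `𝕋`-walk from a site of norm `n` to a site of another norm contains a
`𝕋`-connected set of its sites from a site `a` of norm `n` to its end meeting `∂Λ_n` only at `a`. [folklore] -/
theorem exists_trimmed_member {n : ℕ} {x y : Site 2} (w : triGraph.Walk x y) (hx : triNorm x = n) (hy : triNorm y ≠ n) :
    ∃ (a : Site 2) (E : Set (Site 2)), triNorm a = n ∧ a ∈ E ∧ y ∈ E ∧ (∀ v ∈ E, v ∈ w.support) ∧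
      (∀ v ∈ E, PathIn triGraph E a v) ∧ (∀ v ∈ E, triNorm v = n → v = a) := by
  have hp : PathIn triGraph {v | v ∈ w.support} x y := PathIn.of_walk w fun v hv => hv
  obtain ⟨a, b, ha, haS, hb, hab, hpath⟩ := hp.last_exit (C := {v | triNorm v = (n : ℤ)}) hx hy
  obtain ⟨S, hS, hSp, hSall⟩ := hpath.exists_support
  refine ⟨a, insert a S, ha, Set.mem_insert _ _, Set.mem_insert_of_mem _ hSp.right_mem, ?_, ?_, ?_⟩
  · rintro v (rfl | hv)
    · exact haS
    · exact (hS hv).1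
  · rintro v (rfl | hv)
    · exact PathIn.refl (Set.mem_insert _ _)
    · exact (PathIn.of_adj (Set.mem_insert _ _) (Set.mem_insert_of_mem _ hSp.left_mem) hab).trans
        ((hSall v hv).mono (Set.subset_insert _ _))
  · rintro v (rfl | hv) hvn
    · rfl
    · exact absurd hvn (hS hv).2

/-! ### Two more invariants of the protocol -/

namespace FrameTransversals

variable {M : ℕ} {χ : SiteConfig (Site 2)} {𝒯 : FrameTransversals M χ}

/-- A site of a step is a site of the member or a site of the trapezoid read back (norm `> M`). [folklore] -/
theorem mem_or_lt_of_mem_step {i : ℕ} {E : Set (Site 2)} {a v : Site 2} (hv : v ∈ 𝒯.step i E a) :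
    v ∈ E ∨ (M : ℤ) < triNorm v := by
  obtain ⟨w, hw, rfl⟩ := hv
  cases h : (𝒯.τ i).firstTerm (frameRd i E) ((triRotIsoPow i).symm a) with
  | none =>
    rw [Transversal.mem_reroute_iff_of_none h] at hw
    exact Or.inl (mem_frameRd.1 (Transversal.comp_subset hw))
  | some u =>
    obtain ⟨⟨⟨c, z⟩, hu⟩, -, -⟩ := Transversal.firstTerm_spec h
    rcases Transversal.reroute_subset_union h hu hw with hw | hw
    · exact Or.inl (mem_frameRd.1 hw)
    · right
      rw [triNorm_rot]
      have h1 := (mem_trapD_iff_triNorm.1 ((isCrossing_of_lowestSeq hu).1.subset (Finset.mem_coe.1 hw))).1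
      exact lt_of_lt_of_le h1 ((le_abs_self _).trans (abs_le_triNorm w).1)

/-- **Lower norm bound along the protocol** (`n ≤ M`). [folklore] -/
theorem iter_norm_ge {E : Set (Site 2)} {a : Site 2} {n : ℤ} (hnM : n ≤ M) (hE : ∀ v ∈ E, n ≤ triNorm v) :
    ∀ f, ∀ v ∈ 𝒯.iter f E a, n ≤ triNorm v
  | 0 => hE
  | f + 1 => fun v hv => by
    rcases mem_or_lt_of_mem_step hv with h | h
    · exact iter_norm_ge hnM hE f v h
    · exact hnM.trans h.le

/-- **The members keep meeting `∂Λ_n` only at their start** (`n < M`). [folklore] -/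
theorem iter_eq_start {E : Set (Site 2)} {a : Site 2} {n : ℤ} (hnM : n < M) (hE : ∀ v ∈ E, triNorm v = n → v = a) :
    ∀ f, ∀ v ∈ 𝒯.iter f E a, triNorm v = n → v = a
  | 0 => hE
  | f + 1 => fun v hv hvn => by
    rcases mem_or_lt_of_mem_step hv with h | h
    · exact iter_eq_start hnM hE f v h hvn
    · omega

end FrameTransversals


/-! ### The route of one exit -/

namespace FrameTransversals

variable {M : ℕ} {χ : SiteConfig (Site 2)} (𝒯 : FrameTransversals M χ)

/-- **The route of an exit**: the reading of the final member in its last frame together with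
the connection of the fence of its last term is a `𝕋`-connected open route from the reading of
the start to the exterior fence site, inside the annulus-or-exit-zone, tight outside `Λ_{2M}`,
meeting `∂Λ_n` only at its start. [cite: Nolin2008, §4.4 Lemma 15 and Thm. 11 (proof) (arXiv 0711.4948: Lemma 14, Thm. 10)] -/
theorem exit_route {E : Set (Site 2)} {s : Site 2} {n : ℕ} (hOK : MemberOK M χ E s) (hsn : triNorm s = n)
    (hnM : 2 * n ≤ M) (hn : 1 ≤ n) (hEn : ∀ v ∈ E, (n : ℤ) ≤ triNorm v) (hEs : ∀ v ∈ E, triNorm v = n → v = s)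
    {f u : ℕ} {c : Finset (Site 2)} {z : Site 2} {k : ℕ} (hft : 𝒯.termAt f E s = some u) (hf : f = 𝒯.lastFrame E s)
    (hu : (trapDomain M).lowestSeq (rotConfig f χ) u = some (c, z)) (hraw : TrapRawOK M c z k (rotConfig f χ))
    (hk : 2 ≤ k) (hkM : 31 * (k : ℤ) + 1 ≤ M) (hz8 : -(2 * (M : ℤ)) + 8 * k < z 1 ∧ z 1 + 8 * k < 0)
    (Tf : TermFence M c z k (rotConfig f χ) ↑c) :
    PathIn triGraph (frameRd f (𝒯.final E s) ∪ Tf.F) ((triRotIsoPow f).symm s) Tf.m ∧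
      frameRd f (𝒯.final E s) ∪ Tf.F ⊆ (triAnnSet n (2 * M) ∪ trapExitZone M z k) ∩ rotConfig f χ ∧
      (∀ v ∈ frameRd f (𝒯.final E s) ∪ Tf.F, 2 * (M : ℤ) < triNorm v → ExitTight z k v) ∧
      (∀ v ∈ frameRd f (𝒯.final E s) ∪ Tf.F, triNorm v = n → v = (triRotIsoPow f).symm s) := by
  subst hf
  have hsM : triNorm s ≤ M := by rw [hsn]; exact_mod_cast (by omega : n ≤ M)
  have hfin := memberOK_final (𝒯 := 𝒯) hOK hsM
  have hRd := frameRd_final (𝒯 := 𝒯) hOK hsM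
  have hk1 : 1 ≤ k := by omega
  -- the attachment site lies on the reading of the final member
  have hq : Tf.q ∈ frameRd (𝒯.lastFrame E s) (𝒯.final E s) := by
    rw [hRd]
    exact Transversal.termFence_q_mem_reroute _ hu hraw hk1 hkM hz8 Tf hft
  have hconn : ∀ x ∈ frameRd (𝒯.lastFrame E s) (𝒯.final E s),
      PathIn triGraph (frameRd (𝒯.lastFrame E s) (𝒯.final E s)) ((triRotIsoPow (𝒯.lastFrame E s)).symm s) x := by
    intro x hx
    have := pathIn_frameRd (i := 𝒯.lastFrame E s) (hfin.conn _ (mem_frameRd.1 hx))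
    rwa [RelIso.symm_apply_apply] at this
  have hRdn : ∀ v ∈ frameRd (𝒯.lastFrame E s) (𝒯.final E s), (n : ℤ) ≤ triNorm v ∧ triNorm v ≤ 2 * M := by
    intro v hv
    have hv' := mem_frameRd.1 hv
    refine ⟨?_, ?_⟩
    · have := iter_norm_ge (𝒯 := 𝒯) (a := s) (by exact_mod_cast (by omega : n ≤ M)) hEn 6 _ hv'
      rwa [triNorm_rot] at this
    · have := hfin.norm_le _ hv'
      rwa [triNorm_rot] at this
  have hsub : frameRd (𝒯.lastFrame E s) (𝒯.final E s) ∪ Tf.F ⊆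
      (triAnnSet n (2 * M) ∪ trapExitZone M z k) ∩ rotConfig (𝒯.lastFrame E s) χ := by
    rintro v (hv | hv)
    · exact ⟨Or.inl (mem_triAnnSet.2 (hRdn v hv)), frameRd_subset_rotConfig hfin.subset hv⟩
    · have hv' := Tf.F_subset hv
      exact ⟨Or.inr (trapFrameZone_subset_trapExitZone hv'.1.1.1), fenceSet_subset hv'⟩
  refine ⟨?_, hsub, ?_, ?_⟩
  · have P1 := (hconn _ hq).mono (Set.subset_union_left (t := Tf.F))
    have P2 : PathIn triGraph (frameRd (𝒯.lastFrame E s) (𝒯.final E s) ∪ Tf.F) Tf.q Tf.p :=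
      PathIn.of_adj (Set.mem_union_left _ hq) (Set.mem_union_right _ Tf.p_mem) Tf.adj
    exact P1.trans (P2.trans (Tf.path.mono Set.subset_union_right))
  · rintro v (hv | hv) hvn
    · exact absurd (hRdn v hv).2 (not_le.2 hvn)
    · exact exitTight_of_mem_fenceSet hk (Tf.F_subset hv) hvn
  · rintro v (hv | hv) hvn
    · have hv' := mem_frameRd.1 hv
      have h1n : (1 : ℤ) ≤ n := by exact_mod_cast hn
      have hnM' : (n : ℤ) < M := by omega
      have h := iter_eq_start (𝒯 := 𝒯) (a := s) hnM' hEs 6 _ hv' (by rw [triNorm_rot, hvn])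
      exact (RelIso.symm_apply_apply _ v).symm.trans (congrArg _ h)
    · exfalso
      have hv' := Tf.F_subset hv
      by_cases hvM : triNorm v ≤ 2 * M
      · have h1 := (mem_trapD_iff_triNorm.1 (mem_fenceSet_inside hv' hvM).1).1
        have h2 := (le_abs_self _).trans (abs_le_triNorm v).1
        have : (n : ℤ) ≤ M := by exact_mod_cast (by omega : n ≤ M)
        omega
      · have : (n : ℤ) ≤ M := by exact_mod_cast (by omega : n ≤ M)
        omega

/-! ### Sites of a structure lie in the tip box -/

/-- Fence sites and corner-strip sites lie in the square of half-width `2k + 1` about the tip. [folklore] -/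
theorem box_of_mem_fence_or_strip {c : Finset (Site 2)} {z : Site 2} {k : ℕ} {ω : SiteConfig (Site 2)}
    (Tf : TermFence M c z k ω ↑c) {v : Site 2} (hv : v ∈ Tf.F ∨ v ∈ triStrip (z 0 + k) (z 1 + k) k k) :
    z 0 - (2 * k + 1) ≤ v 0 ∧ v 0 ≤ z 0 + (2 * k + 1) ∧ z 1 - (2 * k + 1) ≤ v 1 ∧ v 1 ≤ z 1 + (2 * k + 1) := by
  rcases hv with hv | hv
  · exact fenceSet_box (Tf.F_subset hv)
  · rw [mem_triStrip] at hv
    omega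

/-- Corner-strip sites are exterior (`z ∈ trapO M`, `1 ≤ k`). [folklore] -/
theorem lt_triNorm_of_mem_strip {z : Site 2} {k : ℕ} (hz : z ∈ trapO M) (hk : 1 ≤ k) {v : Site 2}
    (hv : v ∈ triStrip (z 0 + k) (z 1 + k) k k) : 2 * (M : ℤ) < triNorm v := by
  rw [mem_triStrip] at hv
  have h0 := trapO_coord hz
  have h2 := (le_abs_self _).trans (abs_le_triNorm v).1
  have hk' : (1 : ℤ) ≤ k := by exact_mod_cast hk
  omega

/-! ### Two exits of the same colour -/

/-- **The structures of two exits of the same colour are disjoint, and on a common side their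
tips are distinct and `17k` apart.** The nine pairs (member, fence, corner strip)² are settled by:
disjointness of the final family; no invasion (`not_mem_of_mem_termFence`, in the frame of the
fence); norms (strips are exterior, members are not); same frame — distinct terms
(`termAt_ne_of_disjoint`), `termFence_disjoint_of_lt` and the `17k` row gap; different frames —
the tip boxes of different sides are disjoint (`rot_tipBox_ne`, common scale `κ`). [cite: Nolin2008, §4.4 Lemma 15 and Thm. 11 (proof) (arXiv 0711.4948: Lemma 14, Thm. 10)] -/
theorem same_colour_pair {E E' : Set (Site 2)} {s s' : Site 2} (hOK : MemberOK M χ E s)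
    (hOK' : MemberOK M χ E' s') (hsM : triNorm s ≤ M) (hs'M : triNorm s' ≤ M) (hdisj : Disjoint E E')
    {f u : ℕ} {c : Finset (Site 2)} {z : Site 2} {k : ℕ} (hft : 𝒯.termAt f E s = some u) (hf : f = 𝒯.lastFrame E s)
    (hu : (trapDomain M).lowestSeq (rotConfig f χ) u = some (c, z)) (hraw : TrapRawOK M c z k (rotConfig f χ))
    (hk : 1 ≤ k) (hkM : 32 * (k : ℤ) + 1 ≤ M) (hz8 : -(2 * (M : ℤ)) + 8 * k < z 1 ∧ z 1 + 8 * k < 0)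
    (Tf : TermFence M c z k (rotConfig f χ) ↑c)
    {f' u' : ℕ} {c' : Finset (Site 2)} {z' : Site 2} {k' : ℕ} (hft' : 𝒯.termAt f' E' s' = some u')
    (hf' : f' = 𝒯.lastFrame E' s') (hu' : (trapDomain M).lowestSeq (rotConfig f' χ) u' = some (c', z'))
    (hraw' : TrapRawOK M c' z' k' (rotConfig f' χ)) (hk' : 1 ≤ k') (hk'M : 32 * (k' : ℤ) + 1 ≤ M)
    (hz8' : -(2 * (M : ℤ)) + 8 * k' < z' 1 ∧ z' 1 + 8 * k' < 0) (Tf' : TermFence M c' z' k' (rotConfig f' χ) ↑c')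
    (hf6 : f < 6) (hf'6 : f' < 6)
    (hbox : f ≠ f' → ∃ κ : ℕ, k ≤ κ ∧ k' ≤ κ ∧
      (-(2 * (M : ℤ)) + 8 * κ ≤ z 1 ∧ z 1 ≤ -(8 * (κ : ℤ))) ∧ (-(2 * (M : ℤ)) + 8 * κ ≤ z' 1 ∧ z' 1 ≤ -(8 * (κ : ℤ)))) :
    Disjoint (triRotIsoPow f '' (frameRd f (𝒯.final E s) ∪ Tf.F ∪ triStrip (z 0 + k) (z 1 + k) k k))
        (triRotIsoPow f' '' (frameRd f' (𝒯.final E' s') ∪ Tf'.F ∪ triStrip (z' 0 + k') (z' 1 + k') k' k')) ∧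
      (f = f' → z 1 ≠ z' 1) ∧ (f = f' → z 1 < z' 1 → z 1 + 17 * k < z' 1) := by
  have hcut := trapDomain_cutProp M
  have hc := (isCrossing_of_lowestSeq hu).1
  have hc' := (isCrossing_of_lowestSeq hu').1
  have hz0 := trapO_coord (tip_mem_trapO hc)
  have hz'0 := trapO_coord (tip_mem_trapO hc')
  have hfin := memberOK_final (𝒯 := 𝒯) hOK hsM
  have hfin' := memberOK_final (𝒯 := 𝒯) hOK' hs'M
  have hdfin : Disjoint (𝒯.final E s) (𝒯.final E' s') := disjoint_final hOK hOK' hsM hs'M hdisj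
  -- no invasion, both ways (each in the frame of the fence)
  have hinv' : ∀ x ∈ Tf'.F, x ∉ frameRd f' (𝒯.final E s) := by
    subst hf'
    obtain ⟨h1, h2, h3, h4, h5⟩ := frameRd_final_other (𝒯 := 𝒯) hOK' hOK hs'M hsM hdisj.symm
    intro x hx
    exact Transversal.not_mem_of_mem_termFence _ hu' hraw' hk' hk'M hz8' Tf' hft' h1 h2 h3 h4 h5 hx
  have hinv : ∀ x ∈ Tf.F, x ∉ frameRd f (𝒯.final E' s') := by
    subst hf
    obtain ⟨h1, h2, h3, h4, h5⟩ := frameRd_final_other (𝒯 := 𝒯) hOK hOK' hsM hs'M hdisj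
    intro x hx
    exact Transversal.not_mem_of_mem_termFence _ hu hraw hk hkM hz8 Tf hft h1 h2 h3 h4 h5 hx
  -- norms
  have hRn : ∀ v ∈ frameRd f (𝒯.final E s), triNorm v ≤ 2 * M := fun v hv => by
    have := hfin.norm_le _ (mem_frameRd.1 hv); rwa [triNorm_rot] at this
  have hR'n : ∀ v ∈ frameRd f' (𝒯.final E' s'), triNorm v ≤ 2 * M := fun v hv => by
    have := hfin'.norm_le _ (mem_frameRd.1 hv); rwa [triNorm_rot] at this
  -- same frame: distinct terms, ordered tips
  have hsame : f = f' → u ≠ u' ∧ (z 1 < z' 1 → u < u') ∧ (z' 1 < z 1 → u' < u) ∧ z 1 ≠ z' 1 := by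
    intro hff
    subst hff
    have hne : u ≠ u' := termAt_ne_of_disjoint hOK hOK' hsM hs'M hdisj hft hft'
    have h1 : u < u' → z 1 < z' 1 := fun h => ht_lowestSeq_lt_of_lt hcut h hu hu'
    have h2 : u' < u → z' 1 < z 1 := fun h => ht_lowestSeq_lt_of_lt hcut h hu' hu
    refine ⟨hne, fun h => ?_, fun h => ?_, ?_⟩
    · rcases Nat.lt_or_gt_of_ne hne with h' | h'
      · exact h'
      · have := h2 h'; omega
    · rcases Nat.lt_or_gt_of_ne hne with h' | h'
      · have := h1 h'; omega
      · exact h'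
    · rcases Nat.lt_or_gt_of_ne hne with h' | h'
      · exact (h1 h').ne
      · exact (h2 h').ne'
  refine ⟨?_, fun hff => (hsame hff).2.2.2, fun hff hlt => ?_⟩
  · refine Set.disjoint_left.2 ?_
    rintro X ⟨x₁, hx₁, rfl⟩ ⟨x₂, hx₂, hX⟩
    -- hX : ρ^{f'} x₂ = ρ^{f} x₁
    by_cases hff : f = f'
    · subst hff
      have hx : x₂ = x₁ := (triRotIsoPow f).injective hX
      subst hx
      obtain ⟨hne, hlt, hgt, hzz⟩ := hsame rfl
      -- fences and gaps in the common frame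
      have hFF : Disjoint Tf.F Tf'.F ∧ (u < u' → z 1 + 17 * k < z' 1) ∧ (u' < u → z' 1 + 17 * k' < z 1) := by
        rcases Nat.lt_or_gt_of_ne hne with h | h
        · have := termFence_disjoint_of_lt h hu hu' hraw hk (by omega) Tf Tf'
          exact ⟨this.1, fun _ => this.2, fun h' => absurd h (Nat.lt_asymm h')⟩
        · have := termFence_disjoint_of_lt h hu' hu hraw' hk' (by omega) Tf' Tf
          exact ⟨this.1.symm, fun h' => absurd h (Nat.lt_asymm h'), fun _ => this.2⟩
      obtain ⟨hFdisj, hgap, hgap'⟩ := hFF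
      have hk1 : (1 : ℤ) ≤ k := by exact_mod_cast hk
      have hk1' : (1 : ℤ) ≤ k' := by exact_mod_cast hk'
      rcases hx₁ with (h₁ | h₁) | h₁ <;> rcases hx₂ with (h₂ | h₂) | h₂
      · exact Set.disjoint_left.1 hdfin (mem_frameRd.1 h₁) (mem_frameRd.1 h₂)
      · exact hinv' _ h₂ h₁
      · exact absurd (hRn _ h₁) (not_le.2 (lt_triNorm_of_mem_strip (tip_mem_trapO hc') hk' h₂))
      · exact hinv _ h₁ h₂
      · exact Set.disjoint_left.1 hFdisj h₁ h₂
      · -- fence of `c` against the strip of `c'`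
        have hb₁ := fenceSet_box (Tf.F_subset h₁)
        have hext := lt_triNorm_of_mem_strip (tip_mem_trapO hc') hk' h₂
        have hrow := mem_fenceSet_outside (Tf.F_subset h₁) hext
        rw [mem_triStrip] at h₂
        rcases Nat.lt_or_gt_of_ne hne with h | h
        · have := hgap h; omega
        · have := hgap' h; omega
      · exact absurd (hR'n _ h₂) (not_le.2 (lt_triNorm_of_mem_strip (tip_mem_trapO hc) hk h₁))
      · have hb₂ := fenceSet_box (Tf'.F_subset h₂)
        have hext := lt_triNorm_of_mem_strip (tip_mem_trapO hc) hk h₁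
        have hrow := mem_fenceSet_outside (Tf'.F_subset h₂) hext
        rw [mem_triStrip] at h₁
        rcases Nat.lt_or_gt_of_ne hne with h | h
        · have := hgap h; omega
        · have := hgap' h; omega
      · rw [mem_triStrip] at h₁ h₂
        rcases Nat.lt_or_gt_of_ne hne with h | h
        · have := hgap h; omega
        · have := hgap' h; omega
    · -- different frames
      obtain ⟨κ, hkκ, hk'κ, hzκ, hz'κ⟩ := hbox hff
      have hκ1 : 1 ≤ κ := hk.trans hkκ
      have hkκ' : (k : ℤ) ≤ κ := by exact_mod_cast hkκ
      have hk'κ' : (k' : ℤ) ≤ κ := by exact_mod_cast hk'κ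
      have hboxes : ∀ {v w : Site 2}, (v ∈ Tf.F ∨ v ∈ triStrip (z 0 + k) (z 1 + k) k k) →
          (w ∈ Tf'.F ∨ w ∈ triStrip (z' 0 + k') (z' 1 + k') k' k') → triRotIsoPow f v ≠ triRotIsoPow f' w := by
        intro v w hv hw heq
        have bv := box_of_mem_fence_or_strip Tf hv
        have bw := box_of_mem_fence_or_strip Tf' hw
        exact rot_tipBox_ne hκ1 hzκ hz'κ ⟨by omega, by omega, by omega, by omega⟩
          ⟨by omega, by omega, by omega, by omega⟩ hf6 hf'6 hff heq
      rcases hx₁ with (h₁ | h₁) | h₁ <;> rcases hx₂ with (h₂ | h₂) | h₂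
      · have hX₁ := mem_frameRd.1 h₁
        have hX₂ := mem_frameRd.1 h₂
        rw [hX] at hX₂
        exact Set.disjoint_left.1 hdfin hX₁ hX₂
      · -- member of `E` against the fence of `E'`: no invasion in frame `f'`
        have : x₂ ∈ frameRd f' (𝒯.final E s) := mem_frameRd.2 (by rw [hX]; exact mem_frameRd.1 h₁)
        exact hinv' _ h₂ this
      · have hn₁ := hRn _ h₁
        have hn₂ := lt_triNorm_of_mem_strip (tip_mem_trapO hc') hk' h₂
        rw [← triNorm_rot f x₁, ← hX, triNorm_rot] at hn₁
        exact absurd hn₁ (not_le.2 hn₂)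
      · have : x₁ ∈ frameRd f (𝒯.final E' s') := mem_frameRd.2 (by rw [← hX]; exact mem_frameRd.1 h₂)
        exact hinv _ h₁ this
      · exact hboxes (Or.inl h₁) (Or.inl h₂) hX.symm
      · exact hboxes (Or.inl h₁) (Or.inr h₂) hX.symm
      · have hn₂ := hR'n _ h₂
        have hn₁ := lt_triNorm_of_mem_strip (tip_mem_trapO hc) hk h₁
        rw [← triNorm_rot f' x₂, hX, triNorm_rot] at hn₂
        exact absurd hn₂ (not_le.2 hn₁)
      · exact hboxes (Or.inr h₁) (Or.inl h₂) hX.symm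
      · exact hboxes (Or.inr h₁) (Or.inr h₂) hX.symm
  · obtain ⟨hne, hlt', -, -⟩ := hsame hff
    subst hff
    exact (termFence_disjoint_of_lt (hlt' hlt) hu hu' hraw hk (by omega) Tf Tf').2

end FrameTransversals

/-! ### Two exits of different colours on a common side -/

/-- **Tips of terms of complementary colours on one side are distinct, and a tip of the other
colour is not within `8k` rows above a raw-good tip** (`16k + 1 ≤ M`): otherwise the other term
would be a closed path of the trapezoid from a top-type boundary site of the `8k`-box to the
inner side, excluded by `TrapRawOK.no_escape`. [cite: Nolin2008, §4.4 Lemma 15 and Thm. 11 (proof) (arXiv 0711.4948: Lemma 14, Thm. 10)] -/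
theorem tip_row_gap_of_compl {M k : ℕ} {ω : SiteConfig (Site 2)} {c c' : Finset (Site 2)} {z z' : Site 2}
    (hc : (trapDomain M).IsCrossing c z) (hcω : (↑c : Set (Site 2)) ⊆ ω) (hraw : TrapRawOK M c z k ω) (hk : 1 ≤ k)
    (hkM : 16 * (k : ℤ) + 1 ≤ M) (hc' : (trapDomain M).IsCrossing c' z') (hc'ω : (↑c' : Set (Site 2)) ⊆ ωᶜ) :
    z 1 ≠ z' 1 ∧ (z 1 < z' 1 → z 1 + 8 * k < z' 1) := by
  have hz := tip_mem_trapO hc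
  have hz' := tip_mem_trapO hc'
  have hz0 := trapO_coord hz
  have hz'0 := trapO_coord hz'
  refine ⟨fun hrow => ?_, fun hlt => ?_⟩
  · have hzz : z = z' := by
      ext i; fin_cases i
      · exact hz0.1.trans hz'0.1.symm
      · exact hrow
    exact hc'ω (Finset.mem_coe.2 (hzz ▸ hc'.tip_mem)) (hcω (Finset.mem_coe.2 hc.tip_mem))
  · by_contra h8
    push Not at h8
    obtain ⟨t, htc', htF⟩ := hc'.exists_start
    have ht0 : t 0 = M + 1 := (mem_trapI.1 (by simpa using htF)).2
    have hk' : (1 : ℤ) ≤ k := by exact_mod_cast hk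
    have hq : z' ∈ (trapDomain M).Tp ∪ (trapDomain M).Jabove z := by
      refine Finset.mem_union_right _ (mem_Jabove.2 ⟨?_, ?_⟩)
      · simpa using hz'
      · simpa using hlt
    refine hraw.no_escape hk hc hcω (q := z') (t := t) hq ⟨by omega, by omega, by omega, by omega⟩ (Or.inl (by omega)) ?_
    exact (hc'.conn _ hc'.tip_mem _ htc').mono fun v hv =>
      ⟨Finset.mem_coe.2 (hc'.subset (Finset.mem_coe.1 hv)), hc'ω hv⟩


/-! ### The `k`-exit datum -/

/-- **The `k`-exit datum around `∂Λ_{2M}`** for an arm pattern `κ : Fin k → Bool`: for every arm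
`a`, a frame `i a < 6`, an exit `F a` of the colour `κ a` read in that frame (nominal tip `z` on the
outer side with `8 k_j`-middle row `t a` for every scale `k_j`, scale `k = k_{j a}`, an open
vertical crossing of the corner box through the exterior site `m`, a start of norm `n`) protected
from below (`TipProt`), and an open route `S a` of the colour from the start to `m` inside the
annulus-or-exit-zone, tight outside `Λ_{2M}`, meeting `∂Λ_n` only at its start; the actual
structures (route and corner strip, read back by `ρ^{i a}`) of two arms of the same colour are
disjoint; tips on a common side are distinct, `17k` apart for the same colour (in the order of
the rows) and not within `8k` above for different colours. [cite: Nolin2008, §4.4 Thm. 11 (proof) (arXiv 0711.4948: Thm. 10, p. 12)] -/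
def OutMidExits {k : ℕ} (κ : Fin k → Bool) (P : OParams) : Set (SiteConfig (Site 2)) :=
  {ω | ∃ (i : Fin k → ℕ) (t : Fin k → ℤ) (F : (a : Fin k) → TrapExit P.M P.n P.k₀ P.K (rotConfig (i a) (colCfg (κ a) ω)))
      (S : Fin k → Set (Site 2)),
    (∀ a, i a < 6) ∧ (∀ a, (F a).z 1 = t a) ∧
    (∀ a, ∀ j < P.K, -(2 * (P.M : ℤ)) + 8 * trapScale P.k₀ j < t a ∧ t a + 8 * trapScale P.k₀ j < 0) ∧
    (∀ a, PathIn triGraph (S a) (F a).a (F a).m) ∧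
    (∀ a, S a ⊆ (triAnnSet P.n (2 * P.M) ∪ trapExitZone P.M (F a).z (F a).k) ∩ rotConfig (i a) (colCfg (κ a) ω)) ∧
    (∀ a, ∀ v ∈ S a, 2 * (P.M : ℤ) < triNorm v → ExitTight (F a).z (F a).k v) ∧
    (∀ a, ∀ v ∈ S a, triNorm v = P.n → v = (F a).a) ∧
    (∀ a, TipProt P.M false (t a) (F a).k (rotConfig (i a) (colCfg (κ a) ω))) ∧
    (∀ a b, a ≠ b → κ a = κ b →
      Disjoint (triRotIsoPow (i a) '' (S a ∪ triStrip ((F a).z 0 + (F a).k) ((F a).z 1 + (F a).k) (F a).k (F a).k))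
        (triRotIsoPow (i b) '' (S b ∪ triStrip ((F b).z 0 + (F b).k) ((F b).z 1 + (F b).k) (F b).k (F b).k))) ∧
    (∀ a b, a ≠ b → i a = i b → t a ≠ t b) ∧
    (∀ a b, κ a = κ b → i a = i b → t a < t b → t a + 17 * (F a).k < t b) ∧
    (∀ a b, κ a ≠ κ b → i a = i b → t a < t b → t a + 8 * (F a).k < t b)}

/-- Complementary colours read complementary configurations. [folklore] -/
theorem colCfg_not (b : Bool) (ω : SiteConfig (Site 2)) : colCfg (!b) ω = (colCfg b ω)ᶜ := by
  ext v
  rw [Set.mem_compl_iff, mem_colCfg, mem_colCfg]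
  cases b <;> simp

/-- Rotated frames commute with complements. [folklore] -/
theorem rotConfig_compl' (i : ℕ) (ω : SiteConfig (Site 2)) : rotConfig i ωᶜ = (rotConfig i ω)ᶜ := by
  ext v
  rw [Set.mem_compl_iff, mem_rotConfig, mem_rotConfig, Set.mem_compl_iff]

set_option maxHeartbeats 800000 in
/-- **Nolin's arm separation, outer half, surgery step, any number of arms**: on the good event
around `∂Λ_{2M}` (`AdjGood`: behind each side and for both colours the explorations are short and
rawly good with middle tips), every configuration of the `k`-arm event `armEvent κ n (2M)` carries
a `k`-exit datum. The arms are trimmed at their last visit to `∂Λ_n`, rerouted colour by colour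
over the six frames (`TrapFramesReroute.lean`), and the fence of the last term of each final
member is attached to it (`TrapFenceAttach.lean`). [cite: Nolin2008, §4.4 Thm. 11 (proof) (arXiv 0711.4948: Thm. 10, p. 12)] -/
theorem armEvent_inter_adjGood_subset_outMidExits {k : ℕ} (κ : Fin k → Bool) (P : OParams) {T T' Rg Kg : ℕ}
    (hn : 1 ≤ P.n) (hnM : 2 * P.n ≤ P.M) (hk₀ : 2 ≤ P.k₀) (hKM : ∀ j < P.K, 64 * trapScale P.k₀ j < P.M) :
    armEvent κ P.n (2 * P.M) ∩ {ω | AdjGood P T T' Rg Kg ω} ⊆ OutMidExits κ P := by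
  rintro ω ⟨harm, hgood⟩
  classical
  have hM : 1 ≤ P.M := by omega
  obtain ⟨x, y, w, hw, hwdisj⟩ := harm
  -- trimmed members
  have htrim : ∀ a, ∃ (s : Site 2) (E : Set (Site 2)), triNorm s = P.n ∧ s ∈ E ∧ y a ∈ E ∧
      (∀ v ∈ E, v ∈ (w a).support) ∧ (∀ v ∈ E, PathIn triGraph E s v) ∧ (∀ v ∈ E, triNorm v = P.n → v = s) :=
    fun a => exists_trimmed_member (w a) (mem_triSphere_iff.1 (hw a).1)
      (by rw [mem_triSphere_iff.1 (hw a).2.1]; push_cast; omega)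
  choose s E hs hsE hyE hEw hEconn hEs using htrim
  have hyn : ∀ a, triNorm (y a) = 2 * P.M := fun a => by
    have := mem_triSphere_iff.1 (hw a).2.1
    push_cast at this
    exact this
  have hEcol : ∀ a, E a ⊆ colCfg (κ a) ω := fun a v hv => mem_colCfg.2 ((hw a).2.2.2.2 v (hEw a v hv))
  have hEnorm : ∀ a, ∀ v ∈ E a, (P.n : ℤ) ≤ triNorm v ∧ triNorm v ≤ 2 * P.M := by
    intro a v hv
    rcases (hw a).2.2.2.1 v (hEw a v hv) with h | h
    · have h1 := mem_triBall_iff.1 (Finset.mem_coe.1 h.1)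
      have h2 : ¬ triNorm v ≤ P.n := fun h' => h.2 (Finset.mem_coe.2 (mem_triBall_iff.2 h'))
      push_cast at h1
      exact ⟨by omega, h1⟩
    · rw [mem_triSphere_iff] at h
      exact ⟨h.ge, by rw [h]; exact_mod_cast (by omega : P.n ≤ 2 * P.M)⟩
  have hOK : ∀ a, FrameTransversals.MemberOK P.M (colCfg (κ a) ω) (E a) (s a) := fun a =>
    ⟨hEcol a, fun v hv => (hEnorm a v hv).2, hsE a, hEconn a⟩
  have hsM : ∀ a, triNorm (s a) ≤ P.M := fun a => by rw [hs a]; exact_mod_cast (by omega : P.n ≤ P.M)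
  have hEdisj : ∀ a b, a ≠ b → Disjoint (E a) (E b) := by
    intro a b hab
    refine Set.disjoint_left.2 fun v hva hvb => ?_
    exact Finset.disjoint_left.1 (hwdisj hab) (List.mem_toFinset.2 (hEw a v hva)) (List.mem_toFinset.2 (hEw b v hvb))
  -- the transversals, colour by colour
  let 𝒯 : (b : Bool) → FrameTransversals P.M (colCfg b ω) := fun b => Classical.choice (nonempty_frameTransversals hM _)
  -- last frames and terms
  obtain ⟨f, hfdef⟩ : ∃ f : Fin k → ℕ, ∀ a, f a = (𝒯 (κ a)).lastFrame (E a) (s a) := ⟨_, fun a => rfl⟩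
  have hf6 : ∀ a, f a < 6 := fun a => by rw [hfdef]; exact Nat.lt_succ_of_le (FrameTransversals.lastFrame_le _ _)
  have hterm : ∀ a, ∃ u, (𝒯 (κ a)).termAt (f a) (E a) (s a) = some u := fun a => by
    rw [hfdef]
    exact Option.ne_none_iff_exists'.1 (FrameTransversals.termAt_lastFrame_ne_none hM (hOK a) (hsM a) (hyE a) (hyn a))
  choose u hu using hterm
  have hcz : ∀ a, ∃ cz : Finset (Site 2) × Site 2,
      (trapDomain P.M).lowestSeq (rotConfig (f a) (colCfg (κ a) ω)) (u a) = some cz := fun a => by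
    obtain ⟨c, z, h⟩ := FrameTransversals.exists_lowestSeq_of_term (hu a)
    exact ⟨(c, z), h⟩
  choose cz hcz using hcz
  -- the good events
  have hFG : ∀ a, FrameGood P.M P.k₀ P.K T T' (rotConfig (f a) (colCfg (κ a) ω)) := fun a => (hgood (f a) (hf6 a) (κ a)).1
  have huT : ∀ a, u a < T := fun a => by
    by_contra h
    push Not at h
    have := JDomain.lowestSeq_eq_none_of_le (hFG a).1 h
    rw [hcz a] at this
    exact absurd this (by simp)
  have hraw' : ∀ a, ∃ j < P.K, TrapRawOK P.M (cz a).1 (cz a).2 (trapScale P.k₀ j) (rotConfig (f a) (colCfg (κ a) ω)) :=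
    fun a => exists_trapRawOK_of_not_failRaw ((hFG a).2.1 (u a) (huT a)) (hcz a)
  choose j hjK hraw using hraw'
  have hcr : ∀ a, (trapDomain P.M).IsCrossing (cz a).1 (cz a).2 ∧
      (↑(cz a).1 : Set (Site 2)) ⊆ rotConfig (f a) (colCfg (κ a) ω) := fun a => JDomain.isCrossing_of_lowestSeq (hcz a)
  have hk1 : ∀ a, 1 ≤ trapScale P.k₀ (j a) := fun a => one_le_trapScale (by omega) _
  have hk2 : ∀ a, 2 ≤ trapScale P.k₀ (j a) := fun a => hk₀.trans (le_trapScale _ _)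
  have hkM : ∀ a, 64 * (trapScale P.k₀ (j a) : ℤ) < P.M := fun a => by exact_mod_cast hKM (j a) (hjK a)
  have hz8 : ∀ a, ∀ j' < P.K, -(2 * (P.M : ℤ)) + 8 * trapScale P.k₀ j' < (cz a).2 1 ∧ (cz a).2 1 + 8 * trapScale P.k₀ j' < 0 :=
    fun a j' hj' => (hFG a).2.2.2.2.1 (u a) (cz a).1 (cz a).2 (hcz a) j' hj'
  -- the fences, by components
  have hTf : ∀ a, ∃ (m q p : Site 2) (Fs : Set (Site 2)),
      OpenVCrossThrough (triStrip ((cz a).2 0 + trapScale P.k₀ (j a)) ((cz a).2 1 + trapScale P.k₀ (j a))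
        (trapScale P.k₀ (j a)) (trapScale P.k₀ (j a))) ((cz a).2 1 + trapScale P.k₀ (j a))
        ((cz a).2 1 + 2 * trapScale P.k₀ (j a)) (rotConfig (f a) (colCfg (κ a) ω)) m ∧
      q ∈ (↑(cz a).1 : Set (Site 2)) ∧ triGraph.Adj q p ∧
      Fs ⊆ fenceSet P.M (cz a).1 (cz a).2 (trapScale P.k₀ (j a)) (rotConfig (f a) (colCfg (κ a) ω)) ↑(cz a).1 ∧
      PathIn triGraph Fs p m ∧ (∀ x ∈ Fs, PathIn triGraph Fs p x) := fun a => by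
    obtain ⟨Tf⟩ := (hraw a).nonempty_termFence (hk1 a) (by have := hkM a; omega) (hcr a).1 subset_rfl
      fun v hv => (mem_trapD_iff_triNorm.1 ((hcr a).1.subset (Finset.mem_coe.1 hv))).2
    exact ⟨Tf.m, Tf.q, Tf.p, Tf.F, Tf.vcross, Tf.q_mem, Tf.adj, Tf.F_subset, Tf.path, Tf.tight⟩
  choose m q p Fs hv hq hadj hFs hp htt using hTf
  let mkTf : (a : Fin k) → TermFence P.M (cz a).1 (cz a).2 (trapScale P.k₀ (j a)) (rotConfig (f a) (colCfg (κ a) ω)) ↑(cz a).1 :=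
    fun a => ⟨m a, q a, p a, Fs a, hv a, hq a, hadj a, hFs a, hp a, htt a⟩
  -- single-arm data
  have hroute := fun a => (𝒯 (κ a)).exit_route (hOK a) (hs a) hnM hn (fun v hv => (hEnorm a v hv).1) (hEs a)
    (hu a) (hfdef a) (hcz a) (hraw a) (hk2 a) (by have := hkM a; omega) (hz8 a (j a) (hjK a)) (mkTf a)
  -- pairs of the same colour
  have pair : ∀ a b, a ≠ b → κ a = κ b →
      Disjoint (triRotIsoPow (f a) '' (frameRd (f a) ((𝒯 (κ a)).final (E a) (s a)) ∪ Fs a ∪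
          triStrip ((cz a).2 0 + trapScale P.k₀ (j a)) ((cz a).2 1 + trapScale P.k₀ (j a)) (trapScale P.k₀ (j a)) (trapScale P.k₀ (j a))))
        (triRotIsoPow (f b) '' (frameRd (f b) ((𝒯 (κ b)).final (E b) (s b)) ∪ Fs b ∪
          triStrip ((cz b).2 0 + trapScale P.k₀ (j b)) ((cz b).2 1 + trapScale P.k₀ (j b)) (trapScale P.k₀ (j b)) (trapScale P.k₀ (j b)))) ∧
      (f a = f b → (cz a).2 1 ≠ (cz b).2 1) ∧
      (f a = f b → (cz a).2 1 < (cz b).2 1 → (cz a).2 1 + 17 * trapScale P.k₀ (j a) < (cz b).2 1) := by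
    intro a b hab hκ
    have hbox : f a ≠ f b → ∃ κ₀ : ℕ, trapScale P.k₀ (j a) ≤ κ₀ ∧ trapScale P.k₀ (j b) ≤ κ₀ ∧
        (-(2 * (P.M : ℤ)) + 8 * κ₀ ≤ (cz a).2 1 ∧ (cz a).2 1 ≤ -(8 * (κ₀ : ℤ))) ∧
        (-(2 * (P.M : ℤ)) + 8 * κ₀ ≤ (cz b).2 1 ∧ (cz b).2 1 ≤ -(8 * (κ₀ : ℤ))) := fun _ => by
      have hjm : max (j a) (j b) < P.K := max_lt (hjK a) (hjK b)
      refine ⟨trapScale P.k₀ (max (j a) (j b)), trapScale_mono _ (le_max_left _ _), trapScale_mono _ (le_max_right _ _),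
        ?_, ?_⟩
      · have := hz8 a _ hjm
        constructor <;> omega
      · have := hz8 b _ hjm
        constructor <;> omega
    -- transport the data of `b` to the colour of `a`
    have hOKb : FrameTransversals.MemberOK P.M (colCfg (κ a) ω) (E b) (s b) := by rw [hκ]; exact hOK b
    have hub : (𝒯 (κ a)).termAt (f b) (E b) (s b) = some (u b) := by rw [hκ]; exact hu b
    have hfb : f b = (𝒯 (κ a)).lastFrame (E b) (s b) := by rw [hκ]; exact hfdef b
    have hczb : (trapDomain P.M).lowestSeq (rotConfig (f b) (colCfg (κ a) ω)) (u b) = some (cz b) := by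
      rw [hκ]; exact hcz b
    have hrawb : TrapRawOK P.M (cz b).1 (cz b).2 (trapScale P.k₀ (j b)) (rotConfig (f b) (colCfg (κ a) ω)) := by
      rw [hκ]; exact hraw b
    have hvb : OpenVCrossThrough (triStrip ((cz b).2 0 + trapScale P.k₀ (j b)) ((cz b).2 1 + trapScale P.k₀ (j b))
        (trapScale P.k₀ (j b)) (trapScale P.k₀ (j b))) ((cz b).2 1 + trapScale P.k₀ (j b))
        ((cz b).2 1 + 2 * trapScale P.k₀ (j b)) (rotConfig (f b) (colCfg (κ a) ω)) (m b) := by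
      rw [hκ]; exact hv b
    have hFsb : Fs b ⊆ fenceSet P.M (cz b).1 (cz b).2 (trapScale P.k₀ (j b)) (rotConfig (f b) (colCfg (κ a) ω)) ↑(cz b).1 := by
      rw [hκ]; exact hFs b
    have key := (𝒯 (κ a)).same_colour_pair (hOK a) hOKb (hsM a) (hsM b) (hEdisj a b hab) (hu a) (hfdef a) (hcz a)
      (hraw a) (hk1 a) (by have := hkM a; omega) (hz8 a (j a) (hjK a)) (mkTf a) hub hfb hczb hrawb (hk1 b)
      (by have := hkM b; omega) (hz8 b (j b) (hjK b)) ⟨m b, q b, p b, Fs b, hvb, hq b, hadj b, hFsb, hp b, htt b⟩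
      (hf6 a) (hf6 b) hbox
    refine ⟨?_, key.2.1, key.2.2⟩
    have e : (𝒯 (κ b)).final (E b) (s b) = (𝒯 (κ a)).final (E b) (s b) := by rw [hκ]
    rw [e]
    exact key.1
  -- pairs of different colours on a common side
  have cross : ∀ a b, κ a ≠ κ b → f a = f b →
      (cz a).2 1 ≠ (cz b).2 1 ∧ ((cz a).2 1 < (cz b).2 1 → (cz a).2 1 + 8 * trapScale P.k₀ (j a) < (cz b).2 1) := by
    intro a b hκ hff
    have hcb : colCfg (κ b) ω = (colCfg (κ a) ω)ᶜ := by
      rw [← colCfg_not]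
      have hb : ∀ c d : Bool, c ≠ d → d = !c := by decide
      rw [hb _ _ hκ]
    have hsub : (↑(cz b).1 : Set (Site 2)) ⊆ (rotConfig (f a) (colCfg (κ a) ω))ᶜ := by
      rw [← rotConfig_compl', ← hcb, hff]
      exact (hcr b).2
    exact tip_row_gap_of_compl (hcr a).1 (hcr a).2 (hraw a) (hk1 a) (by have := hkM a; omega) (hcr b).1 hsub
  refine ⟨f, fun a => (cz a).2 1,
    fun a => ⟨(cz a).2, j a, m a, (triRotIsoPow (f a)).symm (s a), tip_mem_trapO (hcr a).1, hjK a,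
      (by rw [triNorm_rot_symm, hs a]), hv a, (hroute a).1.mono (hroute a).2.1⟩,
    fun a => frameRd (f a) ((𝒯 (κ a)).final (E a) (s a)) ∪ Fs a,
    hf6, fun a => rfl, hz8, fun a => (hroute a).1, fun a => (hroute a).2.1, fun a => (hroute a).2.2.1,
    fun a => (hroute a).2.2.2, fun a => ?_, fun a b hab hκ => (pair a b hab hκ).1, fun a b hab hi => ?_,
    fun a b hκ hi hlt => (pair a b ?_ hκ).2.2 hi hlt, fun a b hκ hi hlt => (cross a b hκ hi).2 hlt⟩
  · -- protection
    exact ⟨(cz a).1, (cz a).2, rfl, tip_mem_trapO (hcr a).1, (hcr a).2, fun _ => ⟨(hcr a).1, hraw a⟩,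
      fun h => absurd h (by decide)⟩
  · -- same side: distinct tips
    by_cases hκ : κ a = κ b
    · exact (pair a b hab hκ).2.1 hi
    · exact (cross a b hκ hi).1
  · rintro rfl
    exact lt_irrefl _ hlt

end Literature.Probability.Percolation
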